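import Summits.CriticalPhenomena.CardyFormulaZ2.Theorems.CardySelfDualSegmentSegmentClosed
import Summits.CriticalPhenomena.CardyFormulaZ2.Theorems.CardySelfDualSegmentUniformMarginalityWildFromRectilinear

/-!
# `SegmentClosed` from marginality on RECTILINEAR conformal rectangles only
(crux `UniformMarginality`, stmt-CriticalPhenomena-5472, line `Sketch`; route `CardySelfDualSegment`)

The landed proof of the route item `SegmentClosed` (stmt-CriticalPhenomena-5473,
`segmentClosed_of_stubs` / `segmentClosed_proof`) assumes `UniformMarginality` (UM) for EVERY conformal
rectangle, but uses it only at the test rectangle `R'` of the limit modulus (`stub_identification`). With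
(W) `cardyLimit_of_rectilinear` (sheared Cardy limits pass from rectilinear to arbitrary test domains at a
fixed parameter and modulus) the same argument runs from marginality on RECTILINEAR conformal rectangles:

* `identification_rect`: the `3ε` identification of the limit modulus on rectilinear test domains, from UM
  restricted to rectilinear domains (proof of `stub_identification` verbatim, one hypothesis added);
* `segmentClosed_of_rectilinearMarginality`: UBC → UM_rect → `G` closed, where
  `UM_rect := ∀ t₀, ∀ R rectilinear, ∀ ε > 0, ∃ η > 0, ∀ t, dist t t₀ < η → ∀ δ > 0, |P t R δ − P t₀ R δ| < ε`
  is the crux restricted to rectilinear conformal rectangles (= stub (B₁) of the line, see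
  `uniformMarginalityRect_iff_integratedBoundRectilinear` in `…WildFromRectilinear`) and `G`, UBC are the
  route's, over the tree's `cornerCrossingProb` / `cornerPercolation` (definitionally the route's `P` and law).

Consequence for the planner: the route item `UniformMarginality` may be weakened to UM_rect and the UM
antecedents of `SegmentOpen` / `SegmentClosed` likewise; `SegmentClosed` in that form is THIS theorem, the good
set `G`, `Target`, `SmirnovBasePoint`, `QuarterTurnPinning`, `CrudeToCanonical` and `closes` are untouched.
-/

noncomputable section

open Set Filter Metric Complex
open scoped Topology
open UpperHalfPlane (upperHalfPlaneSet)
open Literature.Probability.RandomPlanarGeometry Literature.Probability.Percolation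
open Literature.Probability.LatticeModels Literature.Barriers.CriticalPhenomena

namespace Summit.CriticalPhenomena.CardyFormulaZ2.Cruxes.UniformMarginality.HeatFlow

open Summit.CriticalPhenomena.CardyFormulaZ2.Cruxes.SegmentClosed.Sketch
  (stub_confinement pullback_constant invParam_im_pos tendsto_crossRatio_shear)

/-- **Identification of the limit modulus on rectilinear test domains** (the landed `stub_identification`
of crux `SegmentClosed` with its marginality hypothesis restricted to rectilinear conformal rectangles, and
accordingly its conclusion): if `CardyMod (t n) (α n)` holds along a sequence with `t n → t₀`, `α n → α₀`,
`im α₀ > 0`, and the crossing probabilities `P` of every RECTILINEAR conformal rectangle are equicontinuous in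
the parameter at `t₀` uniformly in the mesh, then for rectilinear `R'` and `R = φ_{α₀} R'` uniformized by
`(φ, x)`, `P t₀ R' δ → F(crossRatio x)` (Radó for the sheared loops, continuity of `F`, `3ε`). -/
theorem identification_rect (P : unitInterval → ConformalRectangle → ℝ → ℝ)
    (t : ℕ → unitInterval) (t₀ : unitInterval) (α : ℕ → ℂ) (α₀ : ℂ)
    (ht : Tendsto t atTop (𝓝 t₀)) (hα : Tendsto α atTop (𝓝 α₀))
    (hαn : ∀ n, 0 < (α n).im) (hα₀ : 0 < α₀.im)
    (hUM : ∀ R : ConformalRectangle,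
      (∃ S : Finset (ℂ × ℂ), (∀ p ∈ S, p.1.re = p.2.re ∨ p.1.im = p.2.im) ∧
        frontier R.carrier ⊆ ⋃ p ∈ S, segment ℝ p.1 p.2) →
      ∀ ε : ℝ, 0 < ε → ∃ η > 0, ∀ s : unitInterval,
        dist s t₀ < η → ∀ δ : ℝ, 0 < δ → |P s R δ - P t₀ R δ| < ε)
    (hmod : ∀ n (R R' : ConformalRectangle) (φ : ConformalEquiv upperHalfPlaneSet R.carrier)
      (x : Fin 4 → ℝ), R.carrier = moduliShear (α n) '' R'.carrier →
      (∀ i, R.pt i = moduliShear (α n) (R'.pt i)) → R.IsUniformizing φ x →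
      Tendsto (P (t n) R') (𝓝[>] 0)
        (𝓝 (Literature.Probability.RandomPlanarGeometry.cardyFunction (crossRatio x))))
    (R R' : ConformalRectangle)
    (hR' : ∃ S : Finset (ℂ × ℂ), (∀ p ∈ S, p.1.re = p.2.re ∨ p.1.im = p.2.im) ∧
      frontier R'.carrier ⊆ ⋃ p ∈ S, segment ℝ p.1 p.2)
    (φ : ConformalEquiv upperHalfPlaneSet R.carrier) (x : Fin 4 → ℝ)
    (hc : R.carrier = moduliShear α₀ '' R'.carrier) (hp : ∀ i, R.pt i = moduliShear α₀ (R'.pt i))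
    (hu : R.IsUniformizing φ x) :
    Tendsto (P t₀ R') (𝓝[>] 0)
      (𝓝 (Literature.Probability.RandomPlanarGeometry.cardyFunction (crossRatio x))) := by
  -- adapted from `SegmentClosed.Sketch.stub_identification` (hypothesis `hUM` restricted to rectilinear `R`)
  -- uniformizing data of the sheared rectangles `Q n = φ_{α n}(R')`
  choose ψ y hψ using fun n =>
    MarkedDomain.exists_isUniformizing_holds (R'.map (shearHomeomorph (α n) (hαn n).ne'))
  -- `CardyMod (t n) (α n)` tested on `(Q n, R')`
  have hlim : ∀ n, Tendsto (P (t n) R') (𝓝[>] 0)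
      (𝓝 (Literature.Probability.RandomPlanarGeometry.cardyFunction (crossRatio (y n)))) :=
    fun n => hmod n _ R' (ψ n) (y n) rfl (fun _ => rfl) (hψ n)
  -- Radó: the moduli converge
  have hcr : Tendsto (fun n => crossRatio (y n)) atTop (𝓝 (crossRatio x)) :=
    tendsto_crossRatio_shear R R' hα (fun n => (hαn n).ne') hα₀.ne' ψ y hψ φ x hc hp hu
  -- `F` is continuous at `crossRatio x ∈ (0, 1)`
  have hxI : crossRatio x ∈ Ioo (0 : ℝ) 1 :=
    ConformalRectangle.crossRatio_mem_Ioo_of_isUniformizing hu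
  have hFc : ContinuousAt Literature.Probability.RandomPlanarGeometry.cardyFunction (crossRatio x) :=
    continuousOn_cardyFunction_holds.continuousAt (Icc_mem_nhds hxI.1 hxI.2)
  have hF : Tendsto
      (fun n => Literature.Probability.RandomPlanarGeometry.cardyFunction (crossRatio (y n)))
      atTop (𝓝 (Literature.Probability.RandomPlanarGeometry.cardyFunction (crossRatio x))) :=
    hFc.tendsto.comp hcr
  -- the `3ε` exchange of limits, UM used at the rectilinear `R'` only
  rw [Metric.tendsto_nhds]
  intro ε hε
  have hε3 : 0 < ε / 3 := by positivity
  obtain ⟨η, hη, hη'⟩ := hUM R' hR' (ε / 3) hε3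
  obtain ⟨n, hn, hn'⟩ :=
    ((Metric.tendsto_nhds.1 ht η hη).and (Metric.tendsto_nhds.1 hF (ε / 3) hε3)).exists
  filter_upwards [Metric.tendsto_nhds.1 (hlim n) (ε / 3) hε3, self_mem_nhdsWithin]
    with δ hδ hδpos
  have h1 : dist (P t₀ R' δ) (P (t n) R' δ) < ε / 3 := by
    rw [Real.dist_eq, abs_sub_comm]
    exact hη' (t n) hn δ hδpos
  calc dist (P t₀ R' δ) (Literature.Probability.RandomPlanarGeometry.cardyFunction (crossRatio x))
      ≤ dist (P t₀ R' δ) (P (t n) R' δ)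
        + dist (P (t n) R' δ)
            (Literature.Probability.RandomPlanarGeometry.cardyFunction (crossRatio (y n)))
        + dist (Literature.Probability.RandomPlanarGeometry.cardyFunction (crossRatio (y n)))
            (Literature.Probability.RandomPlanarGeometry.cardyFunction (crossRatio x)) :=
        dist_triangle4 _ _ _ _
    _ < ε / 3 + ε / 3 + ε / 3 := add_lt_add (add_lt_add h1 hδ) hn'
    _ = ε := by ring

/-- **`SegmentClosed` from marginality on rectilinear conformal rectangles.** Assuming the uniform
box-crossing property of the corner models `M_t` (UBC, the route crux `UniformBoxCrossing`) and uniform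
marginality for RECTILINEAR conformal rectangles only (the crux `UniformMarginality` restricted to domains
whose boundary is covered by finitely many axis-parallel segments), the good set
`G = {t ∈ [0,1] | ∃ α, 0 < im α ∧ CardyMod t α}` is closed. Proof: the landed confinement of the inverse
parameters (`stub_confinement`, `pullback_constant`) and subsequence extraction exactly as in
`segmentClosed_of_stubs`; the limit modulus is identified on rectilinear test domains by
`identification_rect` and on all test domains by (W) `cardyLimit_of_rectilinear`. -/
theorem segmentClosed_of_rectilinearMarginality :
    (∀ ρ : ℝ, 0 < ρ → ∃ c > 0, ∃ n₀ : ℕ, ∀ t : unitInterval,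
      Literature.Probability.LatticeModels.BoxCrossingBounds
        (Literature.Probability.Percolation.cornerPercolation t)
        Literature.Probability.LatticeModels.squareLatticeEmbedding.z ρ c n₀) →
    (∀ (t₀ : unitInterval) (R : ConformalRectangle),
      (∃ S : Finset (ℂ × ℂ), (∀ p ∈ S, p.1.re = p.2.re ∨ p.1.im = p.2.im) ∧
        frontier R.carrier ⊆ ⋃ p ∈ S, segment ℝ p.1 p.2) →
      ∀ ε : ℝ, 0 < ε → ∃ η > 0, ∀ t : unitInterval, dist t t₀ < η → ∀ δ : ℝ, 0 < δ →
        |Literature.Probability.Percolation.cornerCrossingProb t R δ -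
          Literature.Probability.Percolation.cornerCrossingProb t₀ R δ| < ε) →
    IsClosed {t : unitInterval | ∃ α : ℂ, 0 < α.im ∧
      ∀ (R R' : ConformalRectangle)
        (φ : Literature.Probability.RandomPlanarGeometry.ConformalEquiv UpperHalfPlane.upperHalfPlaneSet R.carrier)
        (x : Fin 4 → ℝ),
        R.carrier = Literature.Barriers.CriticalPhenomena.moduliShear α '' R'.carrier →
        (∀ i, R.pt i = Literature.Barriers.CriticalPhenomena.moduliShear α (R'.pt i)) →
        R.IsUniformizing φ x →
        Filter.Tendsto (Literature.Probability.Percolation.cornerCrossingProb t R') (nhdsWithin 0 (Set.Ioi 0))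
          (nhds (Literature.Probability.RandomPlanarGeometry.cardyFunction
            (Literature.Probability.RandomPlanarGeometry.crossRatio x)))} := by
  -- adapted from `SegmentClosed.Sketch.segmentClosed_of_stubs`
  intro hUBC hUM
  obtain ⟨K, hKc, hKH, hconf⟩ := stub_confinement hUBC
  refine IsSeqClosed.isClosed fun ts t₀ hts hlim => ?_
  choose αs hαs using hts
  set βs : ℕ → ℂ := fun n => (I - ((αs n).re : ℂ)) / ((αs n).im : ℂ) with hβs_def
  have hβs : ∀ n, 0 < (βs n).im := fun n => invParam_im_pos (hαs n).1
  have hβK : ∀ n, βs n ∈ K := fun n =>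
    hconf (ts n) (βs n) (hβs n) fun w h hw hh φ x hx =>
      pullback_constant (hαs n).1 (hαs n).2 (hβs n) w h hw hh φ x hx
  obtain ⟨β₀, hβ₀K, ψ, hψ, hβlim⟩ := hKc.tendsto_subseq hβK
  have hβ₀ : 0 < β₀.im := hKH hβ₀K
  set α₀ : ℂ := (I - (β₀.re : ℂ)) / (β₀.im : ℂ) with hα₀_def
  have hα₀ : 0 < α₀.im := invParam_im_pos hβ₀
  -- the moduli along the subsequence converge to `α₀`
  have hinv : ∀ n, αs n = (I - ((βs n).re : ℂ)) / ((βs n).im : ℂ) := by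
    intro n
    have him : (αs n).im ≠ 0 := (hαs n).1.ne'
    have him' : ((αs n).im : ℂ) ≠ 0 := ofReal_ne_zero.2 him
    apply Complex.ext
    · simp [hβs_def, Complex.div_ofReal_re, Complex.div_ofReal_im]
      field_simp
    · simp [hβs_def, Complex.div_ofReal_re, Complex.div_ofReal_im]
  have hαlim : Tendsto (αs ∘ ψ) atTop (𝓝 α₀) := by
    have hcont : ContinuousAt (fun β : ℂ => (I - (β.re : ℂ)) / (β.im : ℂ)) β₀ := by
      have h1 : ContinuousAt (fun β : ℂ => (I - (β.re : ℂ))) β₀ := by fun_prop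
      have h2 : ContinuousAt (fun β : ℂ => (β.im : ℂ)) β₀ := by fun_prop
      exact h1.div h2 (ofReal_ne_zero.2 hβ₀.ne')
    have h := hcont.tendsto.comp hβlim
    refine (tendsto_congr fun k => ?_).1 h
    simp only [Function.comp_apply]
    exact (hinv (ψ k)).symm
  refine ⟨α₀, hα₀, ?_⟩
  -- identification on rectilinear test domains, then on all of them by (W)
  refine cardyLimit_of_rectilinear t₀ α₀ hα₀ fun R R' φ x hR' hc hp hu => ?_
  exact identification_rect cornerCrossingProb (ts ∘ ψ) t₀ (αs ∘ ψ) α₀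
    (hlim.comp hψ.tendsto_atTop) hαlim (fun n => (hαs (ψ n)).1) hα₀ (hUM t₀)
    (fun n => (hαs (ψ n)).2) R R' hR' φ x hc hp hu

end Summit.CriticalPhenomena.CardyFormulaZ2.Cruxes.UniformMarginality.HeatFlow

end
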